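import Summits.Ventures.Crystal3D.Theorems.StickyWulffConstantTextureLiminfTexShadowTerraceCensusSliver
import Summits.Ventures.Crystal3D.Theorems.StickyWulffConstantTextureBuildLawData
import HarnessLib

/-!
# The registered terrace-census target is OVER-STRONG; its CORE replacement and the glue for the four derived stubs
# (lane T, crux `TextureLiminfV5`, stmt-Ventures-23912, line `TexShadow` v8.21, registered stub `stub_terraceCensus`; 19480-p1 g20, statement audit)

HONEST FRAMING. Venture `Summits/Ventures/Crystal3D` (cell `crystal3d-full`), route `route-Ventures-StickyWulffConstant`, helper `--supports`
the law-v5 crux `TextureLiminfV5` (stmt-Ventures-23912), lane T.  PURE LOGIC about statements already in the tree (…TerraceCensusDefs p726089,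
…TerraceCensusSliver p729881, …CoverageBarlowDefs); nothing about energies is proved; no census is proved; F-C1 not moved.

THE FINDING (§1).  `CensusDominatedAt A₁ A₂ c` constrains the charge `c i j` only on facing bilayer pairs `(i, j)` that ARE related by a reduced
admissible word of length `≥ 2`; on a pair of plates NONE of whose facing bilayer pairs is so related (every generic pair) it is VACUOUS
(`censusDominatedAt_of_noWord`).  Hence the registered `stub_terraceCensus : ∃ C, TerraceCensusAt C 10` asserts, for every such pair, the cell
inequality `BilayerWallAt C 10` for EVERY table admissible at cap `1` — in particular for the constant table `c ≡ 1` when no facing pair is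
co-axial (`bilayerWallAt_one_of_terraceCensusAt`): the CHARGE-ONE generic wall law of law v4, which lane T v5 (cap `13/25`, residual classes)
was built to avoid, and which the terrace mechanism (β) — a statement about word-RELATED pairs — does not address.  The four consumers of the stub
(`stub_edgeOn{RowRead,Apart,Sep,Read}`, all DERIVED through `coreOn_of_terraceCensus_of_sliverRemainder`) only ever use the census in the CORE
shape at cap `13/25`.

THE REPLACEMENT (§2–§3).  The target in the consumers' own shape,
`BilayerWallResidualFaultedCoreOnAt (fun σ₁ σ₂ L₁ L₂ => CensusRegimeAt (13/25) σ₁ σ₂ L₁ L₂) (13/25) C 10`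
(faulted pair, SOME facing bilayer pair in lane G's residual class — hence ray-aligned —, census regime, `13/25`-admissible table, the owed-leaf
disjunction), is IMPLIED by the registered statement (`censusCore_of_terraceCensusAt`, so re-registering it is a weakening) and SUFFICES for the
four derivations (`coreOn_of_censusCore_of_sliverRemainder`, one line each, exactly as before).  The still weaker EDGE-ON form
`… (fun … => Z … ∧ CensusRegimeAt (13/25) …) …` with `Z := EdgeOnAt (13/25)` also suffices (`coreOn_of_censusCoreOn_of_sliverRemainder`, the four
classes lie inside `EdgeOnAt (13/25)`).  Proposed v8.22 text for the planner:
`theorem stub_terraceCensus : ∃ C : ℝ, BilayerWallResidualFaultedCoreOnAt (fun σ₁ σ₂ L₁ L₂ => EdgeOnAt (13 / 25) σ₁ σ₂ L₁ L₂ ∧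
    CensusRegimeAt (13 / 25) σ₁ σ₂ L₁ L₂) (13 / 25) C 10`, each derived stub
`:= by obtain ⟨C, hTC⟩ := stub_terraceCensus; exact coreOn_of_censusCoreOn_of_sliverRemainder _ _ (fun _ _ _ _ hx => <X ⊆ EdgeOn>) hTC stub_…Rem`.
WHAT THIS IS NOT: not a refutation of `TerraceCensusAt` (the charge-one generic law is not known to be false — it is `GenericWallFloor`-hard);
not a proof of any census; F-C1 not moved.
-/

noncomputable section

open scoped BigOperators InnerProductSpace ENNReal
open MeasureTheory Filter

namespace Summit.Ventures.Crystal3D.Cruxes.TextureLiminf.TexShadow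

open Summit.Ventures.Crystal3D Summit.Ventures.Crystal3D.Theorems
open Literature.MathematicalPhysics.StatisticalMechanics (IsHaggSeq fccStacking barlowStacking basalMirror)

/-! ## §1 What the registered statement contains on pairs with no relating word -/

/-- **No relating word ⇒ every table is census-dominated** (the domination clause is vacuous). -/
theorem censusDominatedAt_of_noWord {A₁ A₂ : ℤ → (E3 ≃ₗᵢ[ℝ] E3)}
    (hnw : ∀ (i j : ℤ) (κ : List E3),
      (∀ μ ∈ κ, ‖μ‖ = 1 ∧
        ∀ w ∈ fccSlots, ⟪w, μ⟫_ℝ = 0 ∨ ⟪w, μ⟫_ℝ = Real.sqrt (2 / 3) ∨ ⟪w, μ⟫_ℝ = -Real.sqrt (2 / 3)) →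
      List.IsChain (fun μ μ' => ⟪μ, μ'⟫_ℝ = 1 / 3 ∨ ⟪μ, μ'⟫_ℝ = -1 / 3) κ → 2 ≤ κ.length →
      A₂ j '' fccStacking 1 (Real.sqrt (2 / 3)) ≠ (wordFrame (A₁ i) κ) '' fccStacking 1 (Real.sqrt (2 / 3)))
    (c : ℤ → ℤ → ℝ) : CensusDominatedAt A₁ A₂ c :=
  fun i j κ h₁ h₂ h₃ h₄ => absurd h₄ (hnw i j κ h₁ h₂ h₃)

/-- **The registered statement gives the cell law for EVERY cap-1 admissible table on a pair with no relating word.** -/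
theorem bilayerWallAt_of_terraceCensusAt_of_noWord {C R₀ : ℝ} (h : TerraceCensusAt C R₀)
    {σ₁ σ₂ : ℤ → ℤ} (hσ₁ : IsHaggSeq σ₁) (hσ₂ : IsHaggSeq σ₂) {L₁ L₂ : E3 ≃ₗᵢ[ℝ] E3} {s₁ s₂ : E3}
    {A₁ A₂ : ℤ → (E3 ≃ₗᵢ[ℝ] E3)} {u₁ u₂ : ℤ → E3}
    (hA₁ : BilayerFramesAt L₁ s₁ σ₁ A₁ u₁) (hA₂ : BilayerFramesAt L₂ s₂ σ₂ A₂ u₂)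
    (hnw : ∀ (i j : ℤ) (κ : List E3),
      (∀ μ ∈ κ, ‖μ‖ = 1 ∧
        ∀ w ∈ fccSlots, ⟪w, μ⟫_ℝ = 0 ∨ ⟪w, μ⟫_ℝ = Real.sqrt (2 / 3) ∨ ⟪w, μ⟫_ℝ = -Real.sqrt (2 / 3)) →
      List.IsChain (fun μ μ' => ⟪μ, μ'⟫_ℝ = 1 / 3 ∨ ⟪μ, μ'⟫_ℝ = -1 / 3) κ → 2 ≤ κ.length →
      A₂ j '' fccStacking 1 (Real.sqrt (2 / 3)) ≠ (wordFrame (A₁ i) κ) '' fccStacking 1 (Real.sqrt (2 / 3)))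
    {c : ℤ → ℤ → ℝ} {m : ℤ → ℤ → E3} (hadm : BilayerChargeAdmissible A₁ A₂ c m) :
    BilayerWallAt C R₀ σ₁ σ₂ L₁ L₂ s₁ s₂ c :=
  h σ₁ σ₂ hσ₁ hσ₂ L₁ L₂ s₁ s₂ A₁ A₂ u₁ u₂ hA₁ hA₂ c m hadm (censusDominatedAt_of_noWord hnw c)

/-- **The constant table `1` (axes `0`) is admissible at cap `1` when no facing bilayer pair is co-axial.** -/
theorem bilayerChargeAdmissible_one_of_not_coAx {A₁ A₂ : ℤ → (E3 ≃ₗᵢ[ℝ] E3)} (hnc : ∀ i j : ℤ, ¬ CoAx (A₁ i) (A₂ j)) :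
    BilayerChargeAdmissible A₁ A₂ (fun _ _ => 1) (fun _ _ => 0) :=
  ⟨fun _ _ => zero_le_one, fun _ _ => le_rfl, fun i j hco _ => absurd hco (hnc i j),
    fun i j heq => absurd (coAx_of_image_eq heq) (hnc i j)⟩

/-- **THE REGISTERED STATEMENT CONTAINS THE CHARGE-ONE GENERIC WALL LAW.**  For every pair of presented Barlow plates with bilayer frames none of
whose facing pairs is co-axial and none related by a reduced admissible word of length `≥ 2` — every generic pair — `TerraceCensusAt C R₀` yields
the cell inequality at the constant charge `1`. -/
theorem bilayerWallAt_one_of_terraceCensusAt {C R₀ : ℝ} (h : TerraceCensusAt C R₀)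
    {σ₁ σ₂ : ℤ → ℤ} (hσ₁ : IsHaggSeq σ₁) (hσ₂ : IsHaggSeq σ₂) {L₁ L₂ : E3 ≃ₗᵢ[ℝ] E3} {s₁ s₂ : E3}
    {A₁ A₂ : ℤ → (E3 ≃ₗᵢ[ℝ] E3)} {u₁ u₂ : ℤ → E3}
    (hA₁ : BilayerFramesAt L₁ s₁ σ₁ A₁ u₁) (hA₂ : BilayerFramesAt L₂ s₂ σ₂ A₂ u₂)
    (hnc : ∀ i j : ℤ, ¬ CoAx (A₁ i) (A₂ j))
    (hnw : ∀ (i j : ℤ) (κ : List E3),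
      (∀ μ ∈ κ, ‖μ‖ = 1 ∧
        ∀ w ∈ fccSlots, ⟪w, μ⟫_ℝ = 0 ∨ ⟪w, μ⟫_ℝ = Real.sqrt (2 / 3) ∨ ⟪w, μ⟫_ℝ = -Real.sqrt (2 / 3)) →
      List.IsChain (fun μ μ' => ⟪μ, μ'⟫_ℝ = 1 / 3 ∨ ⟪μ, μ'⟫_ℝ = -1 / 3) κ → 2 ≤ κ.length →
      A₂ j '' fccStacking 1 (Real.sqrt (2 / 3)) ≠ (wordFrame (A₁ i) κ) '' fccStacking 1 (Real.sqrt (2 / 3))) :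
    BilayerWallAt C R₀ σ₁ σ₂ L₁ L₂ s₁ s₂ (fun _ _ => 1) :=
  bilayerWallAt_of_terraceCensusAt_of_noWord h hσ₁ hσ₂ hA₁ hA₂ hnw (bilayerChargeAdmissible_one_of_not_coAx hnc)

/-! ## §2 The replacement target in the consumers' shape is WEAKER than the registered one -/

/-- **Old ⇒ new**: the registered statement gives the census CORE on the census regime at cap `13/25` — the shape every consumer uses. -/
theorem censusCore_of_terraceCensusAt {C R₀ : ℝ} (h : TerraceCensusAt C R₀) :
    BilayerWallResidualFaultedCoreOnAt (fun σ₁ σ₂ L₁ L₂ => CensusRegimeAt (13 / 25) σ₁ σ₂ L₁ L₂) (13 / 25) C R₀ :=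
  residualFaultedCoreOnAt_of_faultedOnAt (faultedOnAt_of_terraceCensus (by norm_num) h)

/-- **Old ⇒ new, restricted to any orientation class `Z`** (e.g. `Z := EdgeOnAt (13/25)`): the census core on `Z ∧ census regime`. -/
theorem censusCoreOn_of_terraceCensusAt (Z : (ℤ → ℤ) → (ℤ → ℤ) → (E3 ≃ₗᵢ[ℝ] E3) → (E3 ≃ₗᵢ[ℝ] E3) → Prop) {C R₀ : ℝ}
    (h : TerraceCensusAt C R₀) :
    BilayerWallResidualFaultedCoreOnAt (fun σ₁ σ₂ L₁ L₂ => Z σ₁ σ₂ L₁ L₂ ∧ CensusRegimeAt (13 / 25) σ₁ σ₂ L₁ L₂) (13 / 25) C R₀ :=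
  coreOn_of_terraceCensus Z h

/-- The plain core gives the `Z`-restricted core (monotonicity in the class). -/
theorem censusCoreOn_of_censusCore (Z : (ℤ → ℤ) → (ℤ → ℤ) → (E3 ≃ₗᵢ[ℝ] E3) → (E3 ≃ₗᵢ[ℝ] E3) → Prop) {c₀ C R₀ : ℝ}
    (h : BilayerWallResidualFaultedCoreOnAt (fun σ₁ σ₂ L₁ L₂ => CensusRegimeAt (13 / 25) σ₁ σ₂ L₁ L₂) c₀ C R₀) :
    BilayerWallResidualFaultedCoreOnAt (fun σ₁ σ₂ L₁ L₂ => Z σ₁ σ₂ L₁ L₂ ∧ CensusRegimeAt (13 / 25) σ₁ σ₂ L₁ L₂) c₀ C R₀ :=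
  residualFaultedCoreOnAt_anti (fun _ _ _ _ hx => hx.2) h

/-! ## §3 Glue: the four derived stubs from the replacement target -/

/-- **Splitting a class stub along the Σ9 sliver from the census CORE** (`R₀ = 10`, cap `13/25`): the core on the census regime plus a registered
remainder on `X ∧ SigmaNineSliverAt` give the core on all of `X` — verbatim the role of `coreOn_of_terraceCensus_of_sliverRemainder`. -/
theorem coreOn_of_censusCore_of_sliverRemainder (X : (ℤ → ℤ) → (ℤ → ℤ) → (E3 ≃ₗᵢ[ℝ] E3) → (E3 ≃ₗᵢ[ℝ] E3) → Prop) {C : ℝ}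
    (h : BilayerWallResidualFaultedCoreOnAt (fun σ₁ σ₂ L₁ L₂ => CensusRegimeAt (13 / 25) σ₁ σ₂ L₁ L₂) (13 / 25) C 10)
    (hrem : ∃ C' : ℝ, BilayerWallResidualFaultedCoreOnAt
      (fun σ₁ σ₂ L₁ L₂ => X σ₁ σ₂ L₁ L₂ ∧ SigmaNineSliverAt σ₁ σ₂ L₁ L₂) (13 / 25) C' 10) :
    ∃ C'' : ℝ, BilayerWallResidualFaultedCoreOnAt X (13 / 25) C'' 10 := by
  obtain ⟨C', h'⟩ := hrem
  exact coreOn_of_zones X (CensusRegimeAt (13 / 25))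
    ⟨C, residualFaultedCoreOnAt_anti (fun _ _ _ _ hx => hx.2) h⟩ ⟨C', remainder_of_sliver X h'⟩

/-- **The same from the `Z`-restricted core, for classes `X ⊆ Z`** (with `Z := EdgeOnAt (13/25)` this serves all four edge-on consumers). -/
theorem coreOn_of_censusCoreOn_of_sliverRemainder
    (X Z : (ℤ → ℤ) → (ℤ → ℤ) → (E3 ≃ₗᵢ[ℝ] E3) → (E3 ≃ₗᵢ[ℝ] E3) → Prop)
    (hXZ : ∀ σ₁ σ₂ L₁ L₂, X σ₁ σ₂ L₁ L₂ → Z σ₁ σ₂ L₁ L₂) {C : ℝ}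
    (h : BilayerWallResidualFaultedCoreOnAt
      (fun σ₁ σ₂ L₁ L₂ => Z σ₁ σ₂ L₁ L₂ ∧ CensusRegimeAt (13 / 25) σ₁ σ₂ L₁ L₂) (13 / 25) C 10)
    (hrem : ∃ C' : ℝ, BilayerWallResidualFaultedCoreOnAt
      (fun σ₁ σ₂ L₁ L₂ => X σ₁ σ₂ L₁ L₂ ∧ SigmaNineSliverAt σ₁ σ₂ L₁ L₂) (13 / 25) C' 10) :
    ∃ C'' : ℝ, BilayerWallResidualFaultedCoreOnAt X (13 / 25) C'' 10 := by
  obtain ⟨C', h'⟩ := hrem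
  exact coreOn_of_zones X (CensusRegimeAt (13 / 25))
    ⟨C, residualFaultedCoreOnAt_anti (fun σ₁ σ₂ L₁ L₂ hx => ⟨hXZ σ₁ σ₂ L₁ L₂ hx.1, hx.2⟩) h⟩
    ⟨C', remainder_of_sliver X h'⟩

/-! ## §4 The four consumers' shapes, from the edge-on census core (what v8.22 would write) -/

/-- `stub_edgeOnRowRead`'s statement (for any apartness regime `Apart`, the skeleton's being `Theorems.LayerRowsApartReg`) from the edge-on census
core and the registered remainder `stub_edgeOnRowReadRem`'s statement. -/
theorem edgeOnRowRead_of_censusCoreOn (Apart : (ℤ → ℤ) → (ℤ → ℤ) → (E3 ≃ₗᵢ[ℝ] E3) → (E3 ≃ₗᵢ[ℝ] E3) → Prop) {C : ℝ}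
    (h : BilayerWallResidualFaultedCoreOnAt
      (fun σ₁ σ₂ L₁ L₂ => EdgeOnAt (13 / 25) σ₁ σ₂ L₁ L₂ ∧ CensusRegimeAt (13 / 25) σ₁ σ₂ L₁ L₂) (13 / 25) C 10)
    (hrem : ∃ C' : ℝ, BilayerWallResidualFaultedCoreOnAt
      (fun σ₁ σ₂ L₁ L₂ => RowReadAt Apart (13 / 25) σ₁ σ₂ L₁ L₂ ∧ SigmaNineSliverAt σ₁ σ₂ L₁ L₂) (13 / 25) C' 10) :
    ∃ C'' : ℝ, BilayerWallResidualFaultedCoreOnAt (RowReadAt Apart (13 / 25)) (13 / 25) C'' 10 :=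
  coreOn_of_censusCoreOn_of_sliverRemainder _ _ (fun _ _ _ _ hx => hx.1) h hrem

/-- `stub_edgeOnApart`'s statement (any `Apart`; the skeleton's is `Theorems.LayerRowsApartReg`) from the edge-on census core and
`stub_edgeOnApartRem`'s statement. -/
theorem edgeOnApart_of_censusCoreOn (Apart : (ℤ → ℤ) → (ℤ → ℤ) → (E3 ≃ₗᵢ[ℝ] E3) → (E3 ≃ₗᵢ[ℝ] E3) → Prop) {C : ℝ}
    (h : BilayerWallResidualFaultedCoreOnAt
      (fun σ₁ σ₂ L₁ L₂ => EdgeOnAt (13 / 25) σ₁ σ₂ L₁ L₂ ∧ CensusRegimeAt (13 / 25) σ₁ σ₂ L₁ L₂) (13 / 25) C 10)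
    (hrem : ∃ C' : ℝ, BilayerWallResidualFaultedCoreOnAt
      (fun σ₁ σ₂ L₁ L₂ => (EdgeOnAt (13 / 25) σ₁ σ₂ L₁ L₂ ∧ FluxPairFailAt (13 / 25) σ₁ σ₂ L₁ L₂ ∧ Apart σ₁ σ₂ L₁ L₂) ∧
        SigmaNineSliverAt σ₁ σ₂ L₁ L₂) (13 / 25) C' 10) :
    ∃ C'' : ℝ, BilayerWallResidualFaultedCoreOnAt
      (fun σ₁ σ₂ L₁ L₂ => EdgeOnAt (13 / 25) σ₁ σ₂ L₁ L₂ ∧ FluxPairFailAt (13 / 25) σ₁ σ₂ L₁ L₂ ∧ Apart σ₁ σ₂ L₁ L₂)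
      (13 / 25) C'' 10 :=
  coreOn_of_censusCoreOn_of_sliverRemainder _ _ (fun _ _ _ _ hx => hx.1) h hrem

/-- `stub_edgeOnSep`'s statement from the edge-on census core and `stub_edgeOnSepRem`'s statement. -/
theorem edgeOnSep_of_censusCoreOn {C : ℝ}
    (h : BilayerWallResidualFaultedCoreOnAt
      (fun σ₁ σ₂ L₁ L₂ => EdgeOnAt (13 / 25) σ₁ σ₂ L₁ L₂ ∧ CensusRegimeAt (13 / 25) σ₁ σ₂ L₁ L₂) (13 / 25) C 10)
    (hrem : ∃ C' : ℝ, BilayerWallResidualFaultedCoreOnAt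
      (fun σ₁ σ₂ L₁ L₂ => (EdgeOnAt (13 / 25) σ₁ σ₂ L₁ L₂ ∧ SepAt (13 / 25) σ₁ σ₂ L₁ L₂) ∧
        SigmaNineSliverAt σ₁ σ₂ L₁ L₂) (13 / 25) C' 10) :
    ∃ C'' : ℝ, BilayerWallResidualFaultedCoreOnAt
      (fun σ₁ σ₂ L₁ L₂ => EdgeOnAt (13 / 25) σ₁ σ₂ L₁ L₂ ∧ SepAt (13 / 25) σ₁ σ₂ L₁ L₂) (13 / 25) C'' 10 :=
  coreOn_of_censusCoreOn_of_sliverRemainder _ _ (fun _ _ _ _ hx => hx.1) h hrem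

/-- `stub_edgeOnRead`'s statement from the edge-on census core and `stub_edgeOnReadRem`'s statement. -/
theorem edgeOnRead_of_censusCoreOn {C : ℝ}
    (h : BilayerWallResidualFaultedCoreOnAt
      (fun σ₁ σ₂ L₁ L₂ => EdgeOnAt (13 / 25) σ₁ σ₂ L₁ L₂ ∧ CensusRegimeAt (13 / 25) σ₁ σ₂ L₁ L₂) (13 / 25) C 10)
    (hrem : ∃ C' : ℝ, BilayerWallResidualFaultedCoreOnAt
      (fun σ₁ σ₂ L₁ L₂ => (EdgeOnAt (13 / 25) σ₁ σ₂ L₁ L₂ ∧ ReadAt (13 / 25) σ₁ σ₂ L₁ L₂) ∧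
        SigmaNineSliverAt σ₁ σ₂ L₁ L₂) (13 / 25) C' 10) :
    ∃ C'' : ℝ, BilayerWallResidualFaultedCoreOnAt
      (fun σ₁ σ₂ L₁ L₂ => EdgeOnAt (13 / 25) σ₁ σ₂ L₁ L₂ ∧ ReadAt (13 / 25) σ₁ σ₂ L₁ L₂) (13 / 25) C'' 10 :=
  coreOn_of_censusCoreOn_of_sliverRemainder _ _ (fun _ _ _ _ hx => hx.1) h hrem

end Summit.Ventures.Crystal3D.Cruxes.TextureLiminf.TexShadow

end
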